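import Summits.ResolutionOfSingularities.ResolutionOfSingularities.Theorems.PurelyInseparableDim4PiPlateauOmegaMoveLaw
import Summits.ResolutionOfSingularities.ResolutionOfSingularities.Theorems.PurelyInseparableDim4IsolatedOrderDichotomy
import HarnessLib

/-!
# Letter consistency under MODE 0: every class survives cleaning; bookkept = literal letters along point-blow-up chains

[OURS · counted 0 · AI kernel work, weaker than expert review]  Nothing here is a statement about resolution of
singularities in dimension ≥ 4 / characteristic `p`, which is NOT proved.  The plateau law Π / the Ω move law
(`…PiPlateau*`, `…PiPlateauOmega*`) are stated in the LITERAL letters of res-dim4-idea-5's write-up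
(`d = HauserPerlega.residualOrder Δ F`, `r = exceptionalExp Δ F`), whereas the cell's engines, certificates and flags
(`…Target`: `CState.shade`, `RiseD`/`DropD`/`EqualD`) read the BOOKKEPT letters `(s.r, s.shade)` of
`CentreBlowup.CState`.  res-dim4-crit-2 (V-B-15) asserted that the two agree on cleaned MODE-0 states; this module
PROVES it, for every `q = p^e`, every field of characteristic `p`, any number of variables:

* §1 **`exists_cls_add_mem_support_step` — EVERY CLASS SURVIVES CLEANING**: for a CLEAN `F` all of whose monomials
  have degree `≥ q` and a MODE-0 edge (`t j = 0`), every class `cls b₀` (`b₀ ∈ supp F`) contributes a monomial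
  `x^{cls b₀} · x^k` to the child.  (If all of them were deleted, `G_{cls b₀} ∈ K[x_T^q]` after un-translating
  (`isPthPowerExponent_support_translate`), `q ∣ (b₀)_U`, `q ∣ |b₀| − q`; so `b₀` itself would be a `q`-th power —
  but `F` is clean.)
* §2 **`exceptionalExp_step_eq_rho`**: for a clean `q`-fold parent, the LITERAL exceptional exponent of the child
  w.r.t. `Δ′` IS `ρ = (r_U).update j (o − q)` (`…PiPlateauBrickData`), i.e. the bookkept one; hence
  `literal_pointState_step` (the literal point state of the child is `PointBlowup.step` of the literal point state of
  the parent) and **`residualOrder_step_eq_shade_pointStep`** (EQUALITY in `…OmegaMoveLaw`'s transfer inequality):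
  every theorem of the tree's point-blow-up files (`PointBlowupMohBound*`, `PointBlowupNoConsecutiveJumps`, …) now
  transfers to literal letters along whole MODE-0 chains, lower bounds and equality cases included.
* §3 CONSISTENT states (`s.r = exceptionalExp s.exc s.F`): consistency PERSISTS under MODE-0 edges from clean `q`-fold
  states (`step_r_eq_exceptionalExp`), and on consistent states `s.shade = residualOrder s.exc s.F`
  (`shade_eq_residualOrder`); roots `(F, 0, ∅)` are consistent (`exceptionalExp_empty`).
* §4 Along `Step0 q` chains of the class `(4,1)` from a clean consistent root: every state is consistent
  (`step0_chain_consistent`), so **`shade_eq_residualOrder_of_step0`** — THE ENGINES' `d` IS THE LITERAL `d` — and the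
  flags of `…Target` read the Ω theorems verbatim: **`riseD_dictionary_of_step0`** (`e = 1`: a `RiseD` edge goes
  `V_p = 0 → 1` and raises the shade by exactly `1`), **`not_riseD_riseD_of_step0`** (no two consecutive `RiseD`),
  `shade_le_shade_add_one_of_step0` (Moh's `e = 1` stability in the frame's own letters).

HONEST LABEL.  Bookkeeping lemmas about OUR frame; the mathematics (Moh / Hasse probe / Π) is in the imported
files.  MODE 0 only: for coordinate centres (`step q S`, `S ≠ univ`) literal and bookkept letters CAN differ (not
treated).  Typed and proved by res-dim4-typ-1 (g2).  Supports stmt-ResolutionOfSingularities-16155 (helper).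
bears_on: LADDER-RESOLUTION:D157-DOOR2 (res-dim4-pi · Π line · letter consistency).
-/

set_option linter.dupNamespace false -- mandated namespace of this single-conjunct summit

namespace Summit.ResolutionOfSingularities.ResolutionOfSingularities.Theorems.PIDim4

namespace Plateau

open MvPolynomial Finset
open Literature.AlgebraicGeometry.Resolution
open Literature.AlgebraicGeometry.Resolution.Hauser2010
open Literature.AlgebraicGeometry.Resolution.CentreBlowup
open Literature.Barriers.ResolutionOfSingularities
open Literature.Barriers.ResolutionOfSingularities.HauserPerlega
open Summit.ResolutionOfSingularities.ResolutionOfSingularities.Theorems.Rescue.BedCylinderTransport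
  (residualOrder_eq_ordZero_sub forall_le_degree_of_ordZero_eq)

section General

variable {σ : Type*} [Fintype σ] [DecidableEq σ] {K : Type*} [Field K] [DecidableEq K]

/-! ## §1 Every class survives cleaning -/

/-- **EVERY CLASS SURVIVES CLEANING.**  For a clean `F` (`q = p^e`) all of whose monomials have degree `≥ q` and a
MODE-0 edge (`t j = 0`): every class `cls b₀`, `b₀ ∈ supp F`, has a monomial `x^{cls b₀} x^k` in the child.
[folklore] -/
theorem exists_cls_add_mem_support_step (p : ℕ) [Fact p.Prime] [CharP K p] (e : ℕ) {j : σ} {t : σ → K}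
    (ht : t j = 0) (s : CState σ K) (hclean : IsClean (p ^ e) s.F) (hq : ∀ b ∈ s.F.support, p ^ e ≤ b.degree)
    {b₀ : σ →₀ ℕ} (hb₀ : b₀ ∈ s.F.support) :
    ∃ k ∈ (classPoly (p ^ e) j t s.F (cls (p ^ e) j t b₀)).support,
      cls (p ^ e) j t b₀ + k ∈ (CentreBlowup.step (p ^ e) Finset.univ j t s).F.support := by
  set q := p ^ e with hqdef
  by_contra hnone
  push Not at hnone
  -- every monomial `x^{cls b₀} x^k` of the class is a `q`-th power
  have hpth : ∀ k ∈ (classPoly q j t s.F (cls q j t b₀)).support, IsPthPowerExponent q (cls q j t b₀ + k) := by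
    intro k hk
    by_contra hnp
    have hku := uPart_eq_zero_of_mem_support_classPoly q j t s.F hk
    apply hnone k hk
    rw [MvPolynomial.mem_support_iff, coeff_cls_add_step q ht s b₀ hku, if_neg hnp]
    exact MvPolynomial.mem_support_iff.mp hk
  have hne : (classPoly q j t s.F (cls q j t b₀)).support.Nonempty :=
    MvPolynomial.support_nonempty.mpr (classPoly_ne_zero q ht s.F hq hb₀)
  obtain ⟨k₀, hk₀⟩ := hne
  -- (a) the untranslated exponents of `b₀` and `|b₀| − q` are divisible by `q`
  have hU : ∀ m, t m = 0 → m ≠ j → q ∣ b₀ m := by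
    intro m htm hmj
    have h := (isPthPowerExponent_iff q _).mp (hpth k₀ hk₀) m
    have hk0 : k₀ m = 0 := apply_eq_zero_of_uPart_eq_zero t (uPart_eq_zero_of_mem_support_classPoly q j t s.F hk₀) htm
    rwa [Finsupp.coe_add, Pi.add_apply, hk0, add_zero, cls_apply, if_neg hmj, if_pos htm] at h
  have hdeg : q ∣ b₀.degree - q := by
    have h := (isPthPowerExponent_iff q _).mp (hpth k₀ hk₀) j
    have hk0 : k₀ j = 0 := apply_eq_zero_of_uPart_eq_zero t (uPart_eq_zero_of_mem_support_classPoly q j t s.F hk₀) ht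
    rwa [Finsupp.coe_add, Pi.add_apply, hk0, add_zero, cls_apply, if_pos rfl] at h
  -- (b) the translated exponents: un-translate the class polynomial
  have hP : ∀ d ∈ (classPoly q j t s.F (cls q j t b₀)).support, IsPthPowerExponent q d := by
    intro k hk
    have h := hpth k hk
    rw [isPthPowerExponent_iff] at h ⊢
    intro m
    have hkm := h m
    by_cases htm : t m = 0
    · rw [apply_eq_zero_of_uPart_eq_zero t (uPart_eq_zero_of_mem_support_classPoly q j t s.F hk) htm]
      exact dvd_zero _
    · have hmj : m ≠ j := fun hh => htm (hh ▸ ht)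
      rwa [Finsupp.coe_add, Pi.add_apply, cls_apply, if_neg hmj, if_neg htm, zero_add] at hkm
  set P₀ : MvPolynomial σ K := ∑ b ∈ s.F.support with cls q j t b = cls q j t b₀,
    monomial (tPart t b) (coeff b s.F) with hP₀
  have hcp : classPoly q j t s.F (cls q j t b₀) = PointBlowup.translate t P₀ := by
    rw [hP₀, classPoly, HasseEuler.translate_sum']
  have hP₀eq : P₀ = PointBlowup.translate (fun i => -t i) (classPoly q j t s.F (cls q j t b₀)) := by
    rw [hcp, PointBlowup.translate_neg_translate]
  have hP₀pth : ∀ d ∈ P₀.support, IsPthPowerExponent q d := by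
    rw [hP₀eq]
    exact isPthPowerExponent_support_translate p e (fun i => -t i) _ hP
  have hmem0 : b₀ ∈ s.F.support.filter (fun b => cls q j t b = cls q j t b₀) :=
    Finset.mem_filter.mpr ⟨hb₀, rfl⟩
  have hmem : tPart t b₀ ∈ P₀.support := by
    rw [MvPolynomial.mem_support_iff, hP₀, coeff_sum, Finset.sum_eq_single_of_mem b₀ hmem0]
    · rw [coeff_monomial, if_pos rfl]
      exact MvPolynomial.mem_support_iff.mp hb₀
    · intro b hb hne
      rw [Finset.mem_filter] at hb
      rw [coeff_monomial, if_neg]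
      intro hT
      exact hne (eq_of_cls_eq_of_tPart_eq q ht (hq b hb.1) (hq b₀ hb₀) hb.2 hT)
  have hT : ∀ m, t m ≠ 0 → q ∣ b₀ m := by
    intro m htm
    have h := (isPthPowerExponent_iff q _).mp (hP₀pth _ hmem) m
    rwa [tPart_apply, if_pos htm] at h
  -- (c) so `b₀` is a `q`-th power exponent: contradiction with cleanness
  have hoff : ∀ m, m ≠ j → q ∣ b₀ m := fun m hmj => by
    by_cases htm : t m = 0
    · exact hU m htm hmj
    · exact hT m htm
  have hsum : b₀.degree = b₀ j + ∑ m ∈ Finset.univ.erase j, b₀ m := by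
    rw [← degIn_univ, degIn, ← Finset.add_sum_erase _ _ (Finset.mem_univ j)]
  have hrest : q ∣ ∑ m ∈ Finset.univ.erase j, b₀ m :=
    Finset.dvd_sum fun m hm => hoff m (Finset.ne_of_mem_erase hm)
  have hdeg' : q ∣ b₀.degree := by
    have hqb := hq b₀ hb₀
    have : b₀.degree = (b₀.degree - q) + q := by omega
    rw [this]
    exact dvd_add hdeg (dvd_refl q)
  have hj : q ∣ b₀ j := by
    have : b₀ j = b₀.degree - ∑ m ∈ Finset.univ.erase j, b₀ m := by omega
    rw [this]
    exact Nat.dvd_sub hdeg' hrest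
  refine hclean b₀ hb₀ ((isPthPowerExponent_iff q b₀).mpr fun m => ?_)
  by_cases hmj : m = j
  · rw [hmj]; exact hj
  · exact hoff m hmj

/-! ## §2 The literal exceptional exponent of the child is `ρ` -/

/-- **The literal exceptional exponent of a MODE-0 child is the bookkept one**: for a clean `q`-fold parent
(`q = p^e`, `ord₀ F = o`) and `t j = 0`, `exceptionalExp Δ′ F′ = ρ = (r_U).update j (o − q)` with
`r = exceptionalExp Δ F`. [folklore] -/
theorem exceptionalExp_step_eq_rho (p : ℕ) [Fact p.Prime] [CharP K p] (e : ℕ) (s : CState σ K) (j : σ)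
    (t : σ → K) (ht : t j = 0) (hclean : IsClean (p ^ e) s.F) {o : ℕ} (ho : ordZero s.F = o)
    (hqo : p ^ e ≤ o) :
    exceptionalExp (CentreBlowup.step (p ^ e) Finset.univ j t s).exc (CentreBlowup.step (p ^ e) Finset.univ j t s).F =
      rho (p ^ e) j t (exceptionalExp s.exc s.F) o := by
  set q := p ^ e with hqdef
  set s' := CentreBlowup.step q Finset.univ j t s with hs'
  have hob : ∀ b ∈ s.F.support, o ≤ b.degree := forall_le_degree_of_ordZero_eq ho le_rfl
  have hq : ∀ b ∈ s.F.support, q ≤ b.degree := fun b hb => hqo.trans (hob b hb)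
  have hr : ∀ b ∈ s.F.support, exceptionalExp s.exc s.F ≤ b :=
    fun b hb => exceptionalExp_le_exponent_of_mem_support s.exc hb
  have hρD : ∀ D ∈ s'.F.support, rho q j t (exceptionalExp s.exc s.F) o ≤ D :=
    fun D hD => rho_le_of_mem_support_step q ht s hr hob hD
  ext m
  by_cases hm : m ∈ s'.exc
  · rw [exceptionalExp_apply_eq_toNat_of_mem _ hm]
    -- a monomial of the child realising `ρ m`
    obtain ⟨D, hD, hDm⟩ : ∃ D ∈ s'.F.support, D m = rho q j t (exceptionalExp s.exc s.F) o m := by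
      have hm' : m ∈ insert j (s.exc.filter fun i => t i = 0) := hm
      rw [Finset.mem_insert, Finset.mem_filter] at hm'
      by_cases hmj : m = j
      · -- the class of an initial monomial
        obtain ⟨⟨b₀, hb₀, hb₀deg⟩, -⟩ := (ordZero_eq_nat_iff _ _).mp ho
        have hb₀s : b₀ ∈ s.F.support := MvPolynomial.mem_support_iff.mpr hb₀
        obtain ⟨k, hk, hD⟩ := exists_cls_add_mem_support_step p e ht s hclean hq hb₀s
        refine ⟨_, hD, ?_⟩
        have hku := uPart_eq_zero_of_mem_support_classPoly q j t s.F hk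
        rw [hmj, Finsupp.coe_add, Pi.add_apply, apply_eq_zero_of_uPart_eq_zero t hku ht, add_zero, cls_apply,
          if_pos rfl, rho_apply, if_pos rfl, hb₀deg]
      · obtain ⟨hmΔ, htm⟩ := hm'.resolve_left hmj
        -- the class of a monomial realising `ord_{(x_m)} F`
        have hF0 : s.F ≠ 0 := by
          rintro h0; rw [h0, ordZero_zero] at ho; exact ENat.top_ne_coe o ho
        have hne : s.F.support.Nonempty := MvPolynomial.support_nonempty.mpr hF0
        obtain ⟨b₀, hb₀s, hb₀m⟩ := Finset.exists_mem_eq_inf s.F.support hne (fun d => ((d m : ℕ) : ℕ∞))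
        obtain ⟨k, hk, hD⟩ := exists_cls_add_mem_support_step p e ht s hclean hq hb₀s
        refine ⟨_, hD, ?_⟩
        have hku := uPart_eq_zero_of_mem_support_classPoly q j t s.F hk
        rw [Finsupp.coe_add, Pi.add_apply, apply_eq_zero_of_uPart_eq_zero t hku htm, add_zero, cls_apply,
          if_neg hmj, if_pos htm, rho_apply, if_neg hmj, if_pos htm, exceptionalExp_apply_eq_toNat_of_mem _ hmΔ]
        unfold HauserPerlega.ordAlong
        rw [hb₀m, ENat.toNat_coe]
    apply le_antisymm
    · have h := ordAlong_le_apply_of_mem_support hD m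
      rw [hDm] at h
      have hne' : ordAlong m s'.F ≠ ⊤ := ne_top_of_le_ne_top (ENat.coe_ne_top _) h
      rw [← ENat.coe_toNat hne'] at h
      exact_mod_cast h
    · have h := natCast_le_ordAlong_of_forall_mem_support m _ fun D hD => hρD D hD m
      have hne' : ordAlong m s'.F ≠ ⊤ :=
        ne_top_of_le_ne_top (ENat.coe_ne_top _) (ordAlong_le_apply_of_mem_support hD m)
      rw [← ENat.coe_toNat hne'] at h
      exact_mod_cast h
  · rw [exceptionalExp_apply_eq_zero_of_not_mem _ hm]
    symm
    by_contra hne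
    exact hm (support_rho_subset q j t s o (Finsupp.mem_support_iff.mpr hne))

/-- **The literal point state of the child is the point-blow-up child of the literal point state of the parent**
(clean `q`-fold parent, `t j = 0`). [folklore] -/
theorem literal_pointState_step (p : ℕ) [Fact p.Prime] [CharP K p] (e : ℕ) (s : CState σ K) (j : σ) (t : σ → K)
    (ht : t j = 0) (hclean : IsClean (p ^ e) s.F) (hF0 : s.F ≠ 0) (hq : ((p ^ e : ℕ) : ℕ∞) ≤ ordZero s.F) :
    (⟨(CentreBlowup.step (p ^ e) Finset.univ j t s).F,
        exceptionalExp (CentreBlowup.step (p ^ e) Finset.univ j t s).exc (CentreBlowup.step (p ^ e) Finset.univ j t s).F⟩ :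
        PointBlowup.State σ K) =
      PointBlowup.step (p ^ e) j t (⟨s.F, exceptionalExp s.exc s.F⟩ : PointBlowup.State σ K) := by
  obtain ⟨o, ho⟩ := exists_ordZero_eq_natCast hF0
  have hqo : p ^ e ≤ o := by rw [ho] at hq; exact_mod_cast hq
  have h1 := step_univ_F_eq_pointStep (p ^ e) j t s (exceptionalExp s.exc s.F)
  have h2 := exceptionalExp_step_eq_rho p e s j t ht hclean ho hqo
  have h3 := pointStep_r_eq_rho (p ^ e) ht s.F (exceptionalExp s.exc s.F) ho
  cases hstep : PointBlowup.step (p ^ e) j t (⟨s.F, exceptionalExp s.exc s.F⟩ : PointBlowup.State σ K) with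
  | mk F' r' =>
    rw [hstep] at h1 h3
    simp only at h1 h3
    rw [h2, h1, ← h3]

/-- **Literal `d′` EQUALS the bookkept shade of the point child of the literal state** (clean `q`-fold parent):
the equality form of `residualOrder_step_le_shade_pointStep`. [folklore] -/
theorem residualOrder_step_eq_shade_pointStep (p : ℕ) [Fact p.Prime] [CharP K p] (e : ℕ) (s : CState σ K)
    (j : σ) (t : σ → K) (ht : t j = 0) (hclean : IsClean (p ^ e) s.F) (hF0 : s.F ≠ 0)
    (hq : ((p ^ e : ℕ) : ℕ∞) ≤ ordZero s.F) :
    residualOrder (CentreBlowup.step (p ^ e) Finset.univ j t s).exc (CentreBlowup.step (p ^ e) Finset.univ j t s).F =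
      (PointBlowup.step (p ^ e) j t (⟨s.F, exceptionalExp s.exc s.F⟩ : PointBlowup.State σ K)).shade := by
  rw [← literal_pointState_step p e s j t ht hclean hF0 hq, shade_literal_eq]

/-! ## §3 Consistent states: bookkept `r` = literal `r` -/

omit [Fintype σ] [DecidableEq σ] [DecidableEq K] in
/-- The root exceptional datum: `exceptionalExp ∅ F = 0` (so a root `(F, 0, ∅)` is consistent). [folklore] -/
theorem exceptionalExp_empty (F : MvPolynomial σ K) : exceptionalExp (∅ : Finset σ) F = 0 := by
  unfold exceptionalExp
  rw [Finset.sum_empty]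

omit [Fintype σ] in
/-- On a CONSISTENT state (`s.r = exceptionalExp s.exc s.F`) the bookkept shade is the literal residual order.
[folklore] -/
theorem shade_eq_residualOrder (s : CState σ K) (hcons : s.r = exceptionalExp s.exc s.F) :
    s.shade = residualOrder s.exc s.F := by
  rw [← shade_literal_eq s, ← hcons]
  rfl

/-- **Consistency persists under MODE-0 edges** from clean `q`-fold states (`t j = 0`). [folklore] -/
theorem step_r_eq_exceptionalExp (p : ℕ) [Fact p.Prime] [CharP K p] (e : ℕ) (s : CState σ K) (j : σ)
    (t : σ → K) (ht : t j = 0) (hclean : IsClean (p ^ e) s.F) (hF0 : s.F ≠ 0)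
    (hq : ((p ^ e : ℕ) : ℕ∞) ≤ ordZero s.F) (hcons : s.r = exceptionalExp s.exc s.F) :
    (CentreBlowup.step (p ^ e) Finset.univ j t s).r =
      exceptionalExp (CentreBlowup.step (p ^ e) Finset.univ j t s).exc (CentreBlowup.step (p ^ e) Finset.univ j t s).F := by
  obtain ⟨o, ho⟩ := exists_ordZero_eq_natCast hF0
  have hqo : p ^ e ≤ o := by rw [ho] at hq; exact_mod_cast hq
  have h1 : (CentreBlowup.step (p ^ e) Finset.univ j t s).r =
      (PointBlowup.step (p ^ e) j t (⟨s.F, s.r⟩ : PointBlowup.State σ K)).r :=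
    congrArg PointBlowup.State.r (step_univ_toState (p ^ e) j t s)
  rw [h1, hcons, pointStep_r_eq_rho (p ^ e) ht s.F _ ho, exceptionalExp_step_eq_rho p e s j t ht hclean ho hqo]

omit [Fintype σ] in
/-- The residual polynomial of a step from `F = 0` is `0`. [folklore] -/
theorem step_F_eq_zero (q : ℕ) (S : Finset σ) (j : σ) (b : σ → K) (s : CState σ K) (h0 : s.F = 0) :
    (CentreBlowup.step q S j b s).F = 0 := by
  show deletePthPowers q (PointBlowup.translate b (chartTransform q S j s.F)) = 0
  unfold chartTransform PointBlowup.translate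
  rw [h0, MvPolynomial.support_zero, Finset.sum_empty, map_zero, deletePthPowers_zero]

end General

/-! ## §4 Along MODE-0 chains of the class `(4,1)`: the engines' `d` is the literal `d` -/

section Chains

variable {K : Type} [Field K] [DecidableEq K]

/-- Every state of a `Step0` chain is non-zero. [folklore] -/
theorem F_ne_zero_of_step0 {q : ℕ} {c : ℕ → State K} (hc : ∀ k, Step0 q (c k) (c (k + 1))) (k : ℕ) :
    (c k).F ≠ 0 := by
  intro h0
  obtain ⟨-, j, b, -, -, -, hne, -⟩ := hc k
  exact hne (step_F_eq_zero q Finset.univ j b (c k) h0)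

/-- **Consistency along `Step0 (p^e)` chains**: from a clean consistent root every state is consistent.
[folklore] -/
theorem step0_chain_consistent (p : ℕ) [Fact p.Prime] [CharP K p] (e : ℕ) {c : ℕ → State K}
    (hc : ∀ k, Step0 (p ^ e) (c k) (c (k + 1))) (h0 : IsClean (p ^ e) (c 0).F)
    (hcons : (c 0).r = exceptionalExp (c 0).exc (c 0).F) (k : ℕ) :
    (c k).r = exceptionalExp (c k).exc (c k).F := by
  induction k with
  | zero => exact hcons
  | succ k ih =>
    have hclean : IsClean (p ^ e) (c k).F := by
      cases k with
      | zero => exact h0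
      | succ k => exact IsolatedBand.isClean_of_step0 (hc k)
    obtain ⟨hq, j, b, -, hbj, -, -, hck⟩ := hc k
    rw [ordAlong_univ] at hq
    rw [hck]
    exact step_r_eq_exceptionalExp p e (c k) j b hbj hclean (F_ne_zero_of_step0 hc k) hq ih

/-- **THE ENGINES' `d` IS THE LITERAL `d`** along every `Step0 (p^e)` chain from a clean consistent root:
`(c k).shade = residualOrder (c k).exc (c k).F`. [folklore] -/
theorem shade_eq_residualOrder_of_step0 (p : ℕ) [Fact p.Prime] [CharP K p] (e : ℕ) {c : ℕ → State K}
    (hc : ∀ k, Step0 (p ^ e) (c k) (c (k + 1))) (h0 : IsClean (p ^ e) (c 0).F)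
    (hcons : (c 0).r = exceptionalExp (c 0).exc (c 0).F) (k : ℕ) :
    (c k).shade = residualOrder (c k).exc (c k).F :=
  shade_eq_residualOrder (c k) (step0_chain_consistent p e hc h0 hcons k)

/-- **`RiseD` dictionary (`e = 1`)**: along a `Step0 p` chain from a clean consistent root, a `RiseD` edge goes
from a `V_p`-INACTIVE state to a `V_p`-ACTIVE one and raises the shade by EXACTLY `1`. [folklore] -/
theorem riseD_dictionary_of_step0 (p : ℕ) [Fact p.Prime] [CharP K p] {c : ℕ → State K}
    (hc : ∀ k, Step0 p (c k) (c (k + 1))) (h0 : IsClean p (c 0).F)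
    (hcons : (c 0).r = exceptionalExp (c 0).exc (c 0).F) (k : ℕ) (hrise : RiseD (c k) (c (k + 1))) :
    ¬ IsVActive p (c k).exc (c k).F ∧ IsVActive p (c (k + 1)).exc (c (k + 1)).F ∧
      (c (k + 1)).shade = (c k).shade + 1 := by
  have hc1 : ∀ k, Step0 (p ^ 1) (c k) (c (k + 1)) := by rw [pow_one]; exact hc
  have h01 : IsClean (p ^ 1) (c 0).F := by rw [pow_one]; exact h0
  have hsk := shade_eq_residualOrder_of_step0 p 1 hc1 h01 hcons k
  have hsk1 := shade_eq_residualOrder_of_step0 p 1 hc1 h01 hcons (k + 1)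
  unfold RiseD at hrise
  rw [hsk, hsk1] at hrise ⊢
  have hclean : IsClean p (c k).F := by
    cases k with
    | zero => exact h0
    | succ k => exact IsolatedBand.isClean_of_step0 (hc k)
  obtain ⟨hq, j, b, -, hbj, -, -, hck⟩ := hc k
  rw [ordAlong_univ] at hq
  rw [hck] at hrise ⊢
  exact rise_dictionary p (c k) j b hbj hclean hq hrise

/-- **No two consecutive `RiseD` edges** along a `Step0 p` chain from a clean consistent root (`e = 1`).
[cite: Hauser2010, §G (kangaroo points)] -/
theorem not_riseD_riseD_of_step0 (p : ℕ) [Fact p.Prime] [CharP K p] {c : ℕ → State K}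
    (hc : ∀ k, Step0 p (c k) (c (k + 1))) (h0 : IsClean p (c 0).F)
    (hcons : (c 0).r = exceptionalExp (c 0).exc (c 0).F) (k : ℕ) (hrise : RiseD (c k) (c (k + 1))) :
    ¬ RiseD (c (k + 1)) (c (k + 2)) := by
  have hc1 : ∀ k, Step0 (p ^ 1) (c k) (c (k + 1)) := by rw [pow_one]; exact hc
  have h01 : IsClean (p ^ 1) (c 0).F := by rw [pow_one]; exact h0
  have hs := fun k => shade_eq_residualOrder_of_step0 p 1 hc1 h01 hcons k
  unfold RiseD at hrise ⊢
  rw [hs, hs] at hrise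
  rw [hs, hs, not_lt]
  have hclean : IsClean p (c k).F := by
    cases k with
    | zero => exact h0
    | succ k => exact IsolatedBand.isClean_of_step0 (hc k)
  obtain ⟨hq, j, b, -, hbj, -, -, hck⟩ := hc k
  obtain ⟨hq', j', b', -, hbj', -, -, hck'⟩ := hc (k + 1)
  rw [ordAlong_univ] at hq hq'
  rw [hck] at hrise hq' hck'
  rw [hck', hck]
  exact residualOrder_step_step_le_of_lt p (c k) j b hbj hclean hq hrise j' b' hbj' hq'

/-- **Moh's `e = 1` one-step bound in the frame's own letters** along a `Step0 p` chain from a clean consistent root: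
`(c (k+1)).shade ≤ (c k).shade + 1`. [cite: Moh1987, Stability Theorem] -/
theorem shade_succ_le_of_step0 (p : ℕ) [Fact p.Prime] [CharP K p] {c : ℕ → State K}
    (hc : ∀ k, Step0 p (c k) (c (k + 1))) (h0 : IsClean p (c 0).F)
    (hcons : (c 0).r = exceptionalExp (c 0).exc (c 0).F) (k : ℕ) :
    (c (k + 1)).shade ≤ (c k).shade + 1 := by
  have hc1 : ∀ k, Step0 (p ^ 1) (c k) (c (k + 1)) := by rw [pow_one]; exact hc
  have h01 : IsClean (p ^ 1) (c 0).F := by rw [pow_one]; exact h0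
  have hs := fun k => shade_eq_residualOrder_of_step0 p 1 hc1 h01 hcons k
  rw [hs, hs]
  have hclean : IsClean (p ^ 1) (c k).F := by
    rw [pow_one]
    cases k with
    | zero => exact h0
    | succ k => exact IsolatedBand.isClean_of_step0 (hc k)
  obtain ⟨hq, j, b, -, hbj, -, -, hck⟩ := hc k
  rw [ordAlong_univ] at hq
  have hq1 : ((p ^ 1 : ℕ) : ℕ∞) ≤ ordZero (c k).F := by rwa [pow_one]
  have h := residualOrder_step_le_add_pow p le_rfl (c k) j b hbj hclean hq1
  simp only [pow_one, Nat.sub_self, pow_zero, Nat.cast_one] at h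
  rw [hck]
  exact h

end Chains

end Plateau

end Summit.ResolutionOfSingularities.ResolutionOfSingularities.Theorems.PIDim4
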